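import Literature.RingTheory.Elimination.TopComponents
import Literature.RingTheory.NoetherNormalization.BoundedProjection
import Literature.Computability.AlgebraicComplexity.BurgisserSimplexLattice
import Literature.Computability.AlgebraicComplexity.BurgisserBooleanPartsA3Steps
import HarnessLib

/-!
# A zero-dimensional square system with small integer coefficients through a point of a solvable
# system (the geometric half of Bürgisser 2000, Thm. 4.5)

Topic: `Literature/Computability/AlgebraicComplexity`. Bürgisser, *Cook's versus Valiant's
hypothesis*, TCS 235 (2000), proof of Thm. 4.5 (p. 82, first paragraph): "By Lemmas 4.3 and 4.4 we
may assume without loss of generality that the set of solutions `V` is finite. To achieve this, we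
may need to replace `w` by `w d^{2n}`" — i.e. from a system `(S)`: `f_1 = … = f_s = 0`,
`f_i ∈ ℤ[X_1, …, X_n]` of degree `≤ d` and weight `≤ w`, solvable over `ℂ`, one passes to a system
of `n` integer polynomials with FINITE complex zero set containing a solution of `(S)`, keeping the
degrees and (the logarithms of) the weights under control. Lemma 4.4 (a linear section making `V`
finite and non-empty) is proved there with projective geometry and Bézout's inequality, and
Lemma 4.3 (Kronecker's method: `n - r` further generic ℕ-combinations of the `f_i`, found in a
simplex of lattice points by Lemma 4.2) counts components with Bézout's inequality.

We PROVE the statement by the elementary route of this library: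
`exists_bounded_projection` (`BoundedProjection.lean`: integer linear forms `L_1, …, L_r` with
`|coeff| ≤ projBound n d`, `V ∩ {L = 0}` finite and non-empty), then Kronecker's method INSIDE the
slice `A = {L = 0}` exactly as in the printed proof of Lemma 4.3 — the `(i+1)`-st combination must
avoid the top-dimensional components of `W_i = A ∩ Z(S̃_1, …, S̃_i)` (they are not contained in
the finite set `V ∩ A`), their number is `≤ (d+2)ⁿ` (`finite_topPrimes_and_ncard_le`, replacing
Bézout), so Bürgisser's simplex Lemma 4.2 (`BurgisserSimplexLattice.lean`) supplies
`a ∈ Δ((d+2)ⁿ)`, and the dimension drops (`dimLE_inter_zeroSet`); after `n - r` steps the set is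
finite (`finite_of_dimLE_zero`).

* **`exists_zeroDim_square_system`** — for `S : Fin s → ℤ[X_1, …, X_n]` of degree `≤ d`, weight
  `≤ w`, solvable over `ℂ`: there is a SQUARE system `F : Fin n → ℤ[X_1, …, X_n]` of degree
  `≤ max d 1`, weight `≤ max ((d+2)ⁿ w) (n · projBound n d)`, with finite complex zero set
  containing a solution of `(S)`.

The weight bound is not Bürgisser's `w d^{2n}` (his linear section has coefficients of size
`d^{O(n)}`); only its logarithm, `≤ 2^{O(n)} log d + log w = d^{O(n)} log w`, enters Thm. 4.5.

## References

* P. Bürgisser, *Cook's versus Valiant's hypothesis*, TCS 235 (2000) 71–88, Lemmas 4.2–4.4 and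
  the proof of Thm. 4.5 (p. 80–82). [Burgisser2000TCS]
-/

noncomputable section

open MvPolynomial
open Literature.RingTheory.Elimination Literature.RingTheory.NoetherNormalization

namespace Literature.Computability.AlgebraicComplexity

/-! ### Auxiliary facts about integer systems and their complex zeros -/

section Aux

variable {n : ℕ}

/-- `aeval z p = eval z (map ℤ→ℂ p)`. [folklore] -/
theorem aeval_eq_eval_map_int (z : Fin n → ℂ) (p : MvPolynomial (Fin n) ℤ) :
    aeval z p = eval z (map (Int.castRingHom ℂ) p) := by
  rw [aeval_def, eval₂_eq_eval_map, algebraMap_int_eq]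

/-- Degrees do not increase under `map`. [folklore] -/
theorem totalDegree_map_int_le (p : MvPolynomial (Fin n) ℤ) :
    (map (Int.castRingHom ℂ) p).totalDegree ≤ p.totalDegree :=
  Finset.sup_mono (support_map_subset _ _)

/-- An `ℕ`-multiple is multiplication by a constant. [folklore] -/
theorem nsmul_eq_C_mul (m : ℕ) (p : MvPolynomial (Fin n) ℤ) : m • p = C (m : ℤ) * p := by
  rw [nsmul_eq_mul, ← map_natCast (C : ℤ →+* MvPolynomial (Fin n) ℤ) m]

/-- Weight of an `ℕ`-combination: `wt(Σ a_k S_k) ≤ (Σ a_k) · max wt(S_k)`. [folklore] -/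
theorem weight_sum_nsmul_le {s : ℕ} (a : Fin s → ℕ) (S : Fin s → MvPolynomial (Fin n) ℤ) {w : ℕ}
    (hw : ∀ k, weight (S k) ≤ w) : weight (∑ k, a k • S k) ≤ (∑ k, a k) * w := by
  refine (weight_finset_sum_le _ _).trans ?_
  rw [Finset.sum_mul]
  refine Finset.sum_le_sum fun k _ => ?_
  rw [nsmul_eq_C_mul]
  refine (weight_mul_le _ _).trans ?_
  rw [weight_C, Int.natAbs_natCast]
  exact Nat.mul_le_mul_left _ (hw k)

/-- Degree of an `ℕ`-combination. [folklore] -/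
theorem totalDegree_sum_nsmul_le {s : ℕ} (a : Fin s → ℕ) (S : Fin s → MvPolynomial (Fin n) ℤ)
    {d : ℕ} (hd : ∀ k, (S k).totalDegree ≤ d) : (∑ k, a k • S k).totalDegree ≤ d := by
  refine totalDegree_finsetSum_le fun k _ => ?_
  rw [nsmul_eq_C_mul]
  exact (totalDegree_mul _ _).trans (by rw [totalDegree_C, zero_add]; exact hd k)

/-- Weight of an integer linear form `Σ_j L_j X_j`: `≤ n · max |L_j|`. [folklore] -/
theorem weight_linearForm_le (L : Fin n → ℤ) {B : ℕ} (hB : ∀ j, |L j| ≤ (B : ℤ)) :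
    weight (∑ j, C (L j) * X j : MvPolynomial (Fin n) ℤ) ≤ n * B := by
  refine (weight_finset_sum_le _ _).trans ?_
  calc ∑ j, weight (C (L j) * X j : MvPolynomial (Fin n) ℤ) ≤ ∑ _j : Fin n, B :=
        Finset.sum_le_sum fun j _ => by
          refine (weight_mul_le _ _).trans ?_
          rw [weight_C, weight_X, mul_one]
          have := hB j
          rw [Int.abs_eq_natAbs] at this
          exact_mod_cast this
    _ = n * B := by rw [Finset.sum_const, Finset.card_univ, Fintype.card_fin, smul_eq_mul]

/-- Values of an integer linear form. [folklore] -/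
theorem aeval_linearForm (L : Fin n → ℤ) (z : Fin n → ℂ) :
    aeval z (∑ j, C (L j) * X j : MvPolynomial (Fin n) ℤ) = ∑ j, (L j : ℂ) * z j := by
  rw [map_sum]
  refine Finset.sum_congr rfl fun j _ => ?_
  rw [map_mul, aeval_C, aeval_X, algebraMap_int_eq, eq_intCast]

end Aux

/-! ### The zero-dimensional square system -/

section Main

variable {n s d w : ℕ}

/-- **A zero-dimensional square system with small integer coefficients through a solution**
(Bürgisser 2000 TCS, proof of Thm. 4.5, first paragraph, with Lemmas 4.2–4.4; here by bounded
linear projection + Kronecker's method with the component count of `TopComponents.lean`). Let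
`S : Fin s → ℤ[X_1, …, X_n]` have degrees `≤ d`, weights `≤ w` and a common complex zero. Then
there is `F : Fin n → ℤ[X_1, …, X_n]` with degrees `≤ max d 1`, weights
`≤ max ((d+2)ⁿ · w) (n · projBound n d)`, FINITE complex zero set, and a common complex zero of
`F` which is also a zero of `S`. [cite: Burgisser2000TCS, Thm. 4.5 (proof) p. 82, Lemmas 4.3–4.4] -/
theorem exists_zeroDim_square_system (S : Fin s → MvPolynomial (Fin n) ℤ)
    (hd : ∀ i, (S i).totalDegree ≤ d) (hw : ∀ i, weight (S i) ≤ w)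
    (hsol : ∃ z : Fin n → ℂ, ∀ i, aeval z (S i) = 0) :
    ∃ F : Fin n → MvPolynomial (Fin n) ℤ,
      (∀ i, (F i).totalDegree ≤ max d 1) ∧
      (∀ i, weight (F i) ≤ max ((d + 2) ^ n * w) (n * projBound n d)) ∧
      {z : Fin n → ℂ | ∀ i, aeval z (F i) = 0}.Finite ∧
      ∃ z : Fin n → ℂ, (∀ i, aeval z (F i) = 0) ∧ ∀ i, aeval z (S i) = 0 := by
  classical
  -- the degenerate case `s = 0`: no equations, take `F_i = X_i`
  rcases Nat.eq_zero_or_pos s with hs0 | hs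
  · subst hs0
    refine ⟨fun i => X i, fun i => ?_, fun i => ?_, ?_, ⟨0, fun i => by simp, fun i => i.elim0⟩⟩
    · rw [totalDegree_X]; exact le_max_right _ _
    · rw [weight_X]
      refine le_trans ?_ (le_max_right _ _)
      have h1 := one_le_projBound n d
      have hn : 1 ≤ n := Nat.succ_le_of_lt (Fin.pos i)
      calc 1 = 1 * 1 := (mul_one 1).symm
        _ ≤ n * projBound n d := Nat.mul_le_mul hn h1
    · refine (Set.finite_singleton (0 : Fin n → ℂ)).subset fun z hz => ?_
      funext i; simpa using hz i
  -- complexified system and its zero set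
  set SC : Fin s → MvPolynomial (Fin n) ℂ := fun i => map (Int.castRingHom ℂ) (S i) with hSC
  set V : Set (Fin n → ℂ) := {z | ∀ i, aeval z (S i) = 0} with hV
  have hVeq : V = {z | ∀ i, eval z (SC i) = 0} := by
    ext z; simp only [hV, hSC, Set.mem_setOf_eq, aeval_eq_eval_map_int]
  set E : Finset (MvPolynomial (Fin n) ℂ) := Finset.univ.image SC with hE
  have hEdeg : ∀ e ∈ E, e.totalDegree ≤ d := by
    intro e he
    obtain ⟨i, -, rfl⟩ := Finset.mem_image.1 he
    exact (totalDegree_map_int_le _).trans (hd i)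
  have hzerosE : zeros E = V := by
    ext z
    rw [mem_zeros, hVeq]
    constructor
    · intro h i; exact h _ (Finset.mem_image.2 ⟨i, Finset.mem_univ _, rfl⟩)
    · intro h e he
      obtain ⟨i, -, rfl⟩ := Finset.mem_image.1 he
      exact h i
  -- the bounded projection
  obtain ⟨r, L, hr, hLbd, hfinL, hsurjL⟩ := exists_bounded_projection (K := ℂ) n d E hEdeg
  rw [hzerosE] at hfinL hsurjL
  have hVne : V.Nonempty := hsol
  -- the slice `A = {L = 0}` and `V ∩ A`
  set Lpoly : Fin r → MvPolynomial (Fin n) ℂ := fun k => ∑ j, C ((L k j : ℤ) : ℂ) * X j with hLpoly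
  have hevalL : ∀ (z : Fin n → ℂ) (k : Fin r), eval z (Lpoly k) = ∑ j, (L k j : ℂ) * z j := by
    intro z k
    rw [hLpoly]
    dsimp only
    rw [map_sum]
    refine Finset.sum_congr rfl fun j _ => ?_
    rw [map_mul, eval_C, eval_X]
  set A : Set (Fin n → ℂ) := {z | ∀ k, ∑ j, (L k j : ℂ) * z j = 0} with hA
  have hVA_fin : (V ∩ A).Finite := by
    refine (hfinL 0).subset ?_
    rintro z ⟨hzV, hzA⟩
    exact ⟨hzV, fun k => by rw [hzA k]; rfl⟩
  have hVA_ne : (V ∩ A).Nonempty := by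
    obtain ⟨z, hzV, hz⟩ := hsurjL hVne 0
    exact ⟨z, hzV, fun k => hz k⟩
  -- independence of the forms (from surjectivity) and `DimLE A (n - r)`
  have hLind : LinearIndependent ℂ (fun k : Fin r => fun j : Fin n => ((L k j : ℤ) : ℂ)) := by
    rw [Fintype.linearIndependent_iff]
    intro g hg k₀
    obtain ⟨z, -, hz⟩ := hsurjL hVne (Pi.single k₀ 1)
    have hj : ∀ j, ∑ k, g k * (L k j : ℂ) = 0 := fun j => by
      have := congrFun hg j
      simpa [Finset.sum_apply, Pi.smul_apply, smul_eq_mul] using this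
    have h1 : ∑ k, g k * (∑ j, (L k j : ℂ) * z j) = 0 := by
      calc ∑ k, g k * (∑ j, (L k j : ℂ) * z j) = ∑ j, (∑ k, g k * (L k j : ℂ)) * z j := by
            simp only [Finset.mul_sum, Finset.sum_mul]
            rw [Finset.sum_comm]
            exact Finset.sum_congr rfl fun j _ => Finset.sum_congr rfl fun k _ => by ring
        _ = 0 := by simp [hj]
    simp only [hz] at h1
    simpa [Pi.single_apply] using h1
  have hdimA : DimLE A (n - r) := dimLE_linearZeros _ hLind
  -- Kronecker's method inside `A`
  set t : ℕ := (d + 2) ^ n with ht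
  haveI : Nonempty (Fin s) := ⟨⟨0, hs⟩⟩
  have key : ∀ i : ℕ, i ≤ n - r → ∃ Sc : Fin i → MvPolynomial (Fin n) ℤ,
      (∀ l, (Sc l).totalDegree ≤ d) ∧ (∀ l, weight (Sc l) ≤ t * w) ∧
      (∀ l, ∀ z ∈ V, aeval z (Sc l) = 0) ∧
      DimLE (A ∩ {z | ∀ l, aeval z (Sc l) = 0}) (n - r - i) := by
    intro i
    induction i with
    | zero =>
      intro _
      refine ⟨fun l => l.elim0, fun l => l.elim0, fun l => l.elim0, fun l => l.elim0, ?_⟩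
      have hset : A ∩ {z : Fin n → ℂ | ∀ l : Fin 0,
          aeval z ((fun l => l.elim0 : Fin 0 → MvPolynomial (Fin n) ℤ) l) = 0} = A := by
        ext z; simp
      rw [hset, Nat.sub_zero]; exact hdimA
    | succ i ih =>
      intro hi
      obtain ⟨Sc, hScd, hScw, hScV, hScdim⟩ := ih (Nat.le_of_succ_le hi)
      set q := n - r - i with hq
      have hq1 : 1 ≤ q := by omega
      set Wi : Set (Fin n → ℂ) := A ∩ {z | ∀ l, aeval z (Sc l) = 0} with hWi
      -- `Wi` as the zero set of `r + i` polynomials of degree `< d + 2`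
      set G : Fin (r + i) → MvPolynomial (Fin n) ℂ :=
        Fin.append Lpoly (fun l => map (Int.castRingHom ℂ) (Sc l)) with hG
      have hWiG : {z : Fin n → ℂ | ∀ m, eval z (G m) = 0} = Wi := by
        ext z
        simp only [Set.mem_setOf_eq, hWi, Set.mem_inter_iff, hA]
        constructor
        · intro h
          refine ⟨fun k => ?_, fun l => ?_⟩
          · have := h (Fin.castAdd i k); rwa [hG, Fin.append_left, hevalL] at this
          · have := h (Fin.natAdd r l); rwa [hG, Fin.append_right, ← aeval_eq_eval_map_int] at this
        · rintro ⟨hzA, hzS⟩ m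
          refine Fin.addCases (fun k => ?_) (fun l => ?_) m
          · rw [hG, Fin.append_left, hevalL]; exact hzA k
          · rw [hG, Fin.append_right, ← aeval_eq_eval_map_int]; exact hzS l
      have hGdeg : ∀ m, (G m).totalDegree < d + 2 := by
        intro m
        refine Fin.addCases (fun k => ?_) (fun l => ?_) m
        · rw [hG, Fin.append_left, hLpoly]
          refine lt_of_le_of_lt (totalDegree_finsetSum_le fun j _ =>
            (totalDegree_mul _ _).trans ?_) (by omega : 1 < d + 2)
          rw [totalDegree_C, totalDegree_X, zero_add]
        · rw [hG, Fin.append_right]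
          exact lt_of_le_of_lt ((totalDegree_map_int_le _).trans (hScd l)) (by omega)
      have hWidim : DimLE {z : Fin n → ℂ | ∀ m, eval z (G m) = 0} q := by rw [hWiG]; exact hScdim
      -- the count of top components
      obtain ⟨hTfin, hTcard⟩ := finite_topPrimes_and_ncard_le (K := ℂ) (j := r + i) (q := q)
        (by omega) (by omega : 1 < d + 2) G hGdeg hWidim
      rw [hWiG] at hTfin hTcard
      -- each top prime misses some `SC k`
      have hmiss : ∀ P ∈ topPrimes Wi q, ∃ k, SC k ∉ P := by
        intro P hP
        refine exists_not_mem_of_topPrime Wi hq1 SC Lpoly (fun z hz k => ?_) ?_ hP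
        · rw [hevalL]; exact hz.1 k
        · have hset : ({x : Fin n → ℂ | ∀ i, eval x (SC i) = 0} ∩ {x | ∀ k, eval x (Lpoly k) = 0}) =
              V ∩ A := by
            ext z
            simp only [Set.mem_inter_iff, Set.mem_setOf_eq, hVeq, hA, hevalL]
          rw [hset]; exact hVA_fin
      -- the proper subspaces and Bürgisser's simplex lemma
      set comb : (Fin s → ℂ) →ₗ[ℂ] MvPolynomial (Fin n) ℂ := Fintype.linearCombination ℂ SC
        with hcomb
      set U : Ideal (MvPolynomial (Fin n) ℂ) → Submodule ℂ (Fin s → ℂ) :=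
        fun P => (P.restrictScalars ℂ).comap comb with hU
      have hUne : ∀ P ∈ topPrimes Wi q, U P ≠ ⊤ := by
        intro P hP hTop
        obtain ⟨k, hk⟩ := hmiss P hP
        have hmem : (Pi.single k 1 : Fin s → ℂ) ∈ U P := by rw [hTop]; trivial
        rw [hU] at hmem
        dsimp only at hmem
        rw [Submodule.mem_comap, Submodule.restrictScalars_mem, hcomb,
          Fintype.linearCombination_apply_single, one_smul] at hmem
        exact hk hmem
      set 𝒰 : Finset (Submodule ℂ (Fin s → ℂ)) := hTfin.toFinset.image U with h𝒰
      have h𝒰ne : ∀ Usub ∈ 𝒰, Usub ≠ ⊤ := by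
        intro Usub hUsub
        obtain ⟨P, hP, rfl⟩ := Finset.mem_image.1 hUsub
        exact hUne P (hTfin.mem_toFinset.1 hP)
      have h𝒰card : 𝒰.card ≤ t := by
        refine Finset.card_image_le.trans ?_
        rw [← Set.ncard_eq_toFinset_card _ hTfin]
        exact hTcard
      obtain ⟨a, hasum, ha⟩ :=
        exists_simplexLatticePoint_forall_not_mem_finset (K := ℂ) 𝒰 h𝒰ne h𝒰card
      -- the new combination
      set Snew : MvPolynomial (Fin n) ℤ := ∑ k, a k • S k with hSnew
      have hSnewC : map (Int.castRingHom ℂ) Snew = comb (fun k => (a k : ℂ)) := by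
        rw [hSnew, map_sum, hcomb, Fintype.linearCombination_apply]
        refine Finset.sum_congr rfl fun k _ => ?_
        rw [map_nsmul, Nat.cast_smul_eq_nsmul ℂ]
      have hnotmem : ∀ P ∈ topPrimes Wi q, map (Int.castRingHom ℂ) Snew ∉ P := by
        intro P hP hmem
        apply ha (U P) (Finset.mem_image.2 ⟨P, hTfin.mem_toFinset.2 hP, rfl⟩)
        rw [hU]
        dsimp only
        rw [Submodule.mem_comap, Submodule.restrictScalars_mem, ← hSnewC]
        exact hmem
      have hSnewV : ∀ z ∈ V, aeval z Snew = 0 := by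
        intro z hz
        rw [hSnew, map_sum]
        refine Finset.sum_eq_zero fun k _ => ?_
        rw [map_nsmul, hz k, nsmul_zero]
      refine ⟨Fin.snoc Sc Snew, fun l => ?_, fun l => ?_, fun l z hz => ?_, ?_⟩
      · refine Fin.lastCases ?_ (fun l' => ?_) l
        · rw [Fin.snoc_last, hSnew]; exact totalDegree_sum_nsmul_le a S hd
        · rw [Fin.snoc_castSucc]; exact hScd l'
      · refine Fin.lastCases ?_ (fun l' => ?_) l
        · rw [Fin.snoc_last, hSnew]
          calc weight (∑ k, a k • S k) ≤ (∑ k, a k) * w := weight_sum_nsmul_le a S hw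
            _ = t * w := by rw [hasum]
        · rw [Fin.snoc_castSucc]; exact hScw l'
      · revert l
        refine Fin.lastCases ?_ (fun l' => ?_)
        · rw [Fin.snoc_last]; exact hSnewV z hz
        · rw [Fin.snoc_castSucc]; exact hScV l' z hz
      · have hset : A ∩ {z : Fin n → ℂ | ∀ l : Fin (i + 1),
            aeval z ((Fin.snoc Sc Snew : Fin (i + 1) → MvPolynomial (Fin n) ℤ) l) = 0} =
            Wi ∩ {z | eval z (map (Int.castRingHom ℂ) Snew) = 0} := by
          ext z
          simp only [Set.mem_inter_iff, Set.mem_setOf_eq, hWi]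
          constructor
          · rintro ⟨hzA, h⟩
            refine ⟨⟨hzA, fun l' => ?_⟩, ?_⟩
            · have := h (Fin.castSucc l'); rwa [Fin.snoc_castSucc] at this
            · have := h (Fin.last i); rwa [Fin.snoc_last, aeval_eq_eval_map_int] at this
          · rintro ⟨⟨hzA, h1⟩, h2⟩
            refine ⟨hzA, fun l => ?_⟩
            refine Fin.lastCases ?_ (fun l' => ?_) l
            · rw [Fin.snoc_last, aeval_eq_eval_map_int]; exact h2
            · rw [Fin.snoc_castSucc]; exact h1 l'
        rw [hset, show n - r - (i + 1) = q - 1 by omega]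
        exact dimLE_inter_zeroSet Wi q _ hScdim hnotmem
  -- the final system
  obtain ⟨Sc, hScd, hScw, hScV, hScdim⟩ := key (n - r) le_rfl
  rw [Nat.sub_self] at hScdim
  have hWfin : (A ∩ {z : Fin n → ℂ | ∀ l, aeval z (Sc l) = 0}).Finite := finite_of_dimLE_zero _ hScdim
  set e : Fin r ⊕ Fin (n - r) ≃ Fin n := finSumFinEquiv.trans (finCongr (by omega)) with he
  set F : Fin n → MvPolynomial (Fin n) ℤ :=
    fun i => Sum.elim (fun k => ∑ j, C (L k j) * X j) Sc (e.symm i) with hF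
  have hZF : {z : Fin n → ℂ | ∀ i, aeval z (F i) = 0} = A ∩ {z | ∀ l, aeval z (Sc l) = 0} := by
    ext z
    simp only [Set.mem_setOf_eq, Set.mem_inter_iff, hA]
    constructor
    · intro hz
      refine ⟨fun k => ?_, fun l => ?_⟩
      · have h := hz (e (Sum.inl k))
        rw [hF] at h; dsimp only at h
        rwa [Equiv.symm_apply_apply, Sum.elim_inl, aeval_linearForm] at h
      · have h := hz (e (Sum.inr l))
        rw [hF] at h; dsimp only at h
        rwa [Equiv.symm_apply_apply, Sum.elim_inr] at h
    · rintro ⟨hzA, hzS⟩ i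
      rw [hF]; dsimp only
      rcases e.symm i with k | l
      · rw [Sum.elim_inl, aeval_linearForm]; exact hzA k
      · rw [Sum.elim_inr]; exact hzS l
  refine ⟨F, fun i => ?_, fun i => ?_, ?_, ?_⟩
  · rw [hF]; dsimp only
    rcases e.symm i with k | l
    · rw [Sum.elim_inl]
      refine le_trans (totalDegree_finsetSum_le fun j _ => (totalDegree_mul _ _).trans ?_)
        (le_max_right _ _)
      rw [totalDegree_C, totalDegree_X, zero_add]
    · rw [Sum.elim_inr]; exact (hScd l).trans (le_max_left _ _)
  · rw [hF]; dsimp only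
    rcases e.symm i with k | l
    · rw [Sum.elim_inl]
      exact (weight_linearForm_le (L k) (hLbd k)).trans (le_max_right _ _)
    · rw [Sum.elim_inr, ht] at *
      exact (hScw l).trans (le_max_left _ _)
  · rw [hZF]; exact hWfin
  · obtain ⟨z, hzV, hzA⟩ := hVA_ne
    refine ⟨z, ?_, hzV⟩
    have : z ∈ {z : Fin n → ℂ | ∀ i, aeval z (F i) = 0} := by
      rw [hZF]; exact ⟨hzA, fun l => hScV l z hzV⟩
    exact this

end Main

end Literature.Computability.AlgebraicComplexity
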